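import Mathlib
import HarnessLib
import Summits.FinalStateConjecture.FinalStateConjecture.Theorems.LogTimeThreeAnnuliDyadicCaptureDefs
import Summits.FinalStateConjecture.FinalStateConjecture.Theorems.LogTimeThreeAnnuliDyadicCaptureKerrSchildRigidity
import Summits.FinalStateConjecture.FinalStateConjecture.Theorems.LogTimeThreeAnnuliDyadicCaptureKerrSchildJets
import Summits.FinalStateConjecture.FinalStateConjecture.Theorems.LogTimeThreeAnnuliDyadicCaptureDyadicSelection
import Summits.FinalStateConjecture.FinalStateConjecture.Theorems.LogTimeThreeAnnuliDyadicCaptureFreezing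
import Summits.FinalStateConjecture.FinalStateConjecture.Theorems.LogTimeThreeAnnuliDyadicCaptureFrozenMemberUnique
import Summits.FinalStateConjecture.FinalStateConjecture.Theorems.LogTimeThreeAnnuliDyadicCaptureRelabelRechart
import Summits.FinalStateConjecture.FinalStateConjecture.Theorems.LogTimeThreeAnnuliDyadicCaptureSettledRechart

/-!
# Route LogTimeThreeAnnuli · crux `DyadicCapture` — the kernel-checked reduction of the crux to ONE open statement

The sorry-free part of the skeleton of line `registered` (`Cruxes/DyadicCapture/Lines/birth.lean`, v5) of the
crux `Summit.FinalStateConjecture.FinalStateConjecture.Theses.LogTimeThreeAnnuli.DyadicCapture`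
(stmt-FinalStateConjecture-17488), landed in the tree WITHOUT importing the route file (so that a future closer can
import it): the crux statement — written out, verbatim its one-step unfolding `ERA(𝒟) → CONCL(𝒟)` — follows from the
single open stub `stub_normalisedWindowwiseSummability` (a horizon-normalised, windowwise dyadically summable honest
era system exists; the route's crux #4 `DyadicSummability` in the inf-sup, growing-slab, gauge-normalised form).

* `dyadicCaptureReduction_windowFreezing` — window freezing (the registered `stub_windowFreezing` signature), a theorem
  of the tree: `stub_freezingAssembly` (p154421) fed with `stub_kerrSchildRigidity` (p147277), `stub_kerrSchildJets`
  (p148001), `stub_dyadicSelection` (p147488).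
* `frozenNormalised_of_normalisedWindowwiseSummability` — stub 1' ⟹ a FROZEN, horizon-normalised honest era system:
  `∃ O d R, IsHonestEraSystem 𝒟 O d R ∧ (∀ i, |d.spin i| < d.mass i) ∧ HasFrozenConvergence 𝒟 O d R d.mass d.spin`
  (window freezing; sub-extremality from the window; the frozen member IS the reference member by
  `stub_frozenMemberUnique`, p162064, and the `C⁰` normalisation clause).
* `dyadicCapture_of_frozenNormalised` — such a system settles as the Statement demands (`stub_relabelRechart`,
  p158712, with labels matching; `stub_settledRechart`, p149044).
* `dyadicCapture_of_normalisedWindowwiseSummability` — the composition: stub 1' ⟹ the crux statement.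

Why the deep v4 stub `stub_horizonRigidity` is not here: see `Cruxes/DyadicCapture/Lines/birth-horizonRigidity-status.md`
(its exhaustion argument fails when the reference domain reaches the frozen member's inner horizon radius). Sources:
Dafermos–Luk arXiv:1710.01722, Conjecture 1 (b)–(c); Klainerman, C. R. Mécanique 353 (2025), §2.3; Simon,
Ann. Math. 118 (1983), §0 (uniqueness of limits from summable decay); DHRT arXiv:2104.08222, §1 (the norms).
-/

-- the `Summit.FinalStateConjecture.FinalStateConjecture.…` namespace repeats the summit = sub-problem
-- segment (D-0017 layout, CONVENTIONS §2); the duplicate is deliberate.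
set_option linter.dupNamespace false

noncomputable section

namespace Summit.FinalStateConjecture.FinalStateConjecture.Theorems

open Literature.Geometry.Lorentzian
open scoped Topology Manifold ENNReal ContDiff
open Filter Set

/-- **Exactly matching labels match up to the spin sign** (registered helper `dyadicCaptureReduction_abs_eq`, the
name under which this reduction file is attached to the crux item; used to feed `stub_relabelRechart`). [folklore] -/
theorem dyadicCaptureReduction_abs_eq : ∀ (M a M' a' : ℝ), M = M' → a = a' → M = M' ∧ |a| = |a'| := by
  intro M a M' a' hM ha
  exact ⟨hM, by rw [ha]⟩

/-- **Window membership forces sub-extremality**: `0 < m₀ ≤ M` and `|a| ≤ χM` with `χ < 1` give `0 < M` and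
`|a| < M`. [folklore] -/
theorem dyadicCaptureReduction_subextremal_of_window {m₀ χ M a : ℝ} (hm₀ : 0 < m₀) (hχ : χ < 1) (hM : m₀ ≤ M)
    (ha : |a| ≤ χ * M) : 0 < M ∧ |a| < M := by
  have hMpos : 0 < M := lt_of_lt_of_le hm₀ hM
  refine ⟨hMpos, lt_of_le_of_lt ha ?_⟩
  have h := mul_lt_mul_of_pos_right hχ hMpos
  simpa using h

/-- **Window freezing** (the registered signature of `stub_windowFreezing` of the line, a THEOREM of the tree):
windowwise summability in a chart system ⟹ frozen window parameters with `Cᵏ` convergence in the same charts, on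
fixed and growing slabs. [cite: Simon1983, §0] -/
theorem dyadicCaptureReduction_windowFreezing :
    ∀ (𝓢 : Spacetime.{0} 4) (O : Set 𝓢.carrier) (d : QuasiFinalStateDecomposition 𝓢 O 2 ⊤) (R : Fin d.N → ℝ → ℝ) (m₀ χ : ℝ), 0 < m₀ → χ < 1 → (∀ (i : Fin d.N) (k : ℕ) (ρ : ℝ), ∃ n₀ : ℕ, (∑' n : ℕ, ⨅ (M : ℝ) (a : ℝ) (_ : m₀ ≤ M ∧ M ≤ m₀⁻¹ ∧ |a| ≤ χ * M), ⨆ τ ∈ Set.Icc ((2 : ℝ) ^ (n₀ + n)) ((2 : ℝ) ^ (n₀ + n + 1)), (𝓢.truncDeviationCk {d.background i with bilin := boostedKerrBilin (d.motion i).1 (d.motion i).2 M a} (d.chart i) k ρ τ + 𝓢.truncDeviationCk {d.background i with bilin := boostedKerrBilin (d.motion i).1 (d.motion i).2 M a} (d.chart i) k (R i τ) τ)) ≠ ⊤) → ∃ (M a : Fin d.N → ℝ), (∀ i : Fin d.N, m₀ ≤ M i ∧ M i ≤ m₀⁻¹ ∧ |a i| ≤ χ * M i) ∧ (∀ (i :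 Fin d.N) (k : ℕ) (ρ : ℝ), Filter.Tendsto (fun τ => 𝓢.truncDeviationCk {d.background i with bilin := boostedKerrBilin (d.motion i).1 (d.motion i).2 (M i) (a i)} (d.chart i) k ρ τ) Filter.atTop (nhds 0)) ∧ (∀ (i : Fin d.N) (k : ℕ), Filter.Tendsto (fun τ => 𝓢.truncDeviationCk {d.background i with bilin := boostedKerrBilin (d.motion i).1 (d.motion i).2 (M i) (a i)} (d.chart i) k (R i τ) τ) Filter.atTop (nhds 0)) :=
  stub_freezingAssembly stub_kerrSchildRigidity stub_kerrSchildJets stub_dyadicSelection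

/-- **Stub 1' ⟹ a frozen, horizon-normalised honest era system.** From a horizon-normalised windowwise-summable
honest system (the conclusion of `stub_normalisedWindowwiseSummability`), window freezing gives frozen window
members `(Mᵢ, aᵢ)` with `Cᵏ` convergence on fixed and growing slabs; the window makes them sub-extremal; the `C⁰`
normalisation clause and `stub_frozenMemberUnique` identify `(Mᵢ, aᵢ) = (d.mass i, d.spin i)`. Sorry-free.
[cite: Simon1983, §0] -/
theorem frozenNormalised_of_normalisedWindowwiseSummability
    (h₁ : ∀ (X : Type) [TopologicalSpace X] [ChartedSpace E3 X] [IsManifold (𝓡 3) ((⊤ : ℕ∞) : WithTop ℕ∞) X] [T2Space X] [SecondCountableTopology X] [ConnectedSpace X], ∀ D ∈ admissibleVacuumData X, ∀ 𝒟 : VacuumCauchyDevelopment D, 𝒟.IsMaximal → Summit.FinalStateConjecture.HasCompleteNullInfinity 𝒟.toCauchyDevelopment → (∃ (m₀ χ : ℝ) (O : Set 𝒟.carrier) (d : QuasiFinalStateDecomposition 𝒟.toSpacetime O 2 ⊤) (R : Fin d.N → ℝ → ℝ), 0 < m₀ ∧ χ < 1 ∧ O = Summit.FinalStateConjecture.exteriorOf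 𝒟.toCauchyDevelopment d.charted ∧ Summit.FinalStateConjecture.RaysStayInClosure 𝒟.toCauchyDevelopment O ∧ (∀ i : Fin d.N, Filter.Tendsto (R i) Filter.atTop Filter.atTop ∧ ∀ τ : ℝ, max (Kerr.rPlus (d.mass i) (d.spin i)) 0 + 1 ≤ R i τ) ∧ (∀ τ₁ : ℝ, d.τ₀ < τ₁ → O \ d.certifiedLate R τ₁ ⊆ 𝒟.metric.causalPast 𝒟.timeOrientation (d.certifiedSlab R τ₁)) ∧ (∀ i : Fin d.N, Summit.FinalStateConjecture.IsOrthochronous (d.motion i).1) ∧ (∀ (i : Fin d.N) (ρ : ℝ), ∀ᶠ τ in Filter.atTop, ∀ x ∈ (d.background i).truncTimeSlab ρ τ, ∀ w : E4, 𝒟.timeOrientation.IsFutureDirected (mfderiv 𝓘(ℝ, E4) (𝓡 4) (d.chart i) x w) → 0 < ((d.motion i).1 : E4 ≃L[ℝ] E4).symm w 0) ∧ (∀ᶠ τ in Filter.atTop, ∀ x ∈ (Minkowski.backgroundOn d.flatDomain).timeSlab τ, 𝒟.timeOrientation.IsFutureDirected (mfderiv 𝓘(ℝ, E4) (𝓡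 4) d.flatChart x (E4.basisVector 0))) ∧ (∀ k : ℕ, Filter.Tendsto (fun τ => 𝒟.toSpacetime.deviationCk (Minkowski.backgroundOn d.flatDomain) d.flatChart k τ) Filter.atTop (nhds 0)) ∧ (∀ (i : Fin d.N) (k : ℕ) (ρ : ℝ) (ε : ENNReal), 0 < ε → ∀ᶠ τ in Filter.atTop, ∃ M a : ℝ, m₀ ≤ M ∧ M ≤ m₀⁻¹ ∧ |a| ≤ χ * M ∧ 𝒟.toSpacetime.truncDeviationCk {d.background i with bilin := boostedKerrBilin (d.motion i).1 (d.motion i).2 M a} (d.chart i) k ρ τ ≤ ε ∧ 𝒟.toSpacetime.truncDeviationCk {d.background i with bilin := boostedKerrBilin (d.motion i).1 (d.motion i).2 M a} (d.chart i) k (R i τ) τ ≤ ε)) → ∃ (m₀ χ : ℝ) (O : Set 𝒟.carrier) (d : QuasiFinalStateDecomposition 𝒟.toSpacetime O 2 ⊤) (R : Fin d.N → ℝ → ℝ), 0 < m₀ ∧ χ < 1 ∧ O = Summit.FinalStateConjecture.exteriorOf 𝒟.toCauchyDevelopment d.charted ∧ Summit.FinalStateConjecture.RaysStayInClosure 𝒟.toCauchyDevelopment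 O ∧ (∀ i : Fin d.N, Filter.Tendsto (R i) Filter.atTop Filter.atTop ∧ ∀ τ : ℝ, max (Kerr.rPlus (d.mass i) (d.spin i)) 0 + 1 ≤ R i τ) ∧ (∀ τ₁ : ℝ, d.τ₀ < τ₁ → O \ d.certifiedLate R τ₁ ⊆ 𝒟.metric.causalPast 𝒟.timeOrientation (d.certifiedSlab R τ₁)) ∧ (∀ i : Fin d.N, Summit.FinalStateConjecture.IsOrthochronous (d.motion i).1) ∧ (∀ (i : Fin d.N) (ρ : ℝ), ∀ᶠ τ in Filter.atTop, ∀ x ∈ (d.background i).truncTimeSlab ρ τ, ∀ w : E4, 𝒟.timeOrientation.IsFutureDirected (mfderiv 𝓘(ℝ, E4) (𝓡 4) (d.chart i) x w) → 0 < ((d.motion i).1 : E4 ≃L[ℝ] E4).symm w 0) ∧ (∀ᶠ τ in Filter.atTop, ∀ x ∈ (Minkowski.backgroundOn d.flatDomain).timeSlab τ, 𝒟.timeOrientation.IsFutureDirected (mfderiv 𝓘(ℝ, E4) (𝓡 4) d.flatChart x (E4.basisVector 0))) ∧ (∀ k : ℕ, Filter.Tendsto (fun τ => 𝒟.toSpacetime.deviationCk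 (Minkowski.backgroundOn d.flatDomain) d.flatChart k τ) Filter.atTop (nhds 0)) ∧ (∀ (i : Fin d.N) (k : ℕ) (ρ : ℝ), ∃ n₀ : ℕ, (∑' n : ℕ, ⨅ (M : ℝ) (a : ℝ) (_ : m₀ ≤ M ∧ M ≤ m₀⁻¹ ∧ |a| ≤ χ * M), ⨆ τ ∈ Set.Icc ((2 : ℝ) ^ (n₀ + n)) ((2 : ℝ) ^ (n₀ + n + 1)), (𝒟.toSpacetime.truncDeviationCk {d.background i with bilin := boostedKerrBilin (d.motion i).1 (d.motion i).2 M a} (d.chart i) k ρ τ + 𝒟.toSpacetime.truncDeviationCk {d.background i with bilin := boostedKerrBilin (d.motion i).1 (d.motion i).2 M a} (d.chart i) k (R i τ) τ)) ≠ ⊤) ∧ (∀ (i : Fin d.N) (ρ : ℝ), Filter.Tendsto (fun τ => 𝒟.toSpacetime.truncDeviationCk {d.background i with bilin := boostedKerrBilin (d.motion i).1 (d.motion i).2 (d.mass i) (d.spin i)} (d.chart i) 0 ρ τ) Filter.atTop (nhds 0))) :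
    ∀ (X : Type) [TopologicalSpace X] [ChartedSpace E3 X] [IsManifold (𝓡 3) ((⊤ : ℕ∞) : WithTop ℕ∞) X] [T2Space X] [SecondCountableTopology X] [ConnectedSpace X], ∀ D ∈ admissibleVacuumData X, ∀ 𝒟 : VacuumCauchyDevelopment D, 𝒟.IsMaximal → Summit.FinalStateConjecture.HasCompleteNullInfinity 𝒟.toCauchyDevelopment → (∃ (m₀ χ : ℝ) (O : Set 𝒟.carrier) (d : QuasiFinalStateDecomposition 𝒟.toSpacetime O 2 ⊤) (R : Fin d.N → ℝ → ℝ), 0 < m₀ ∧ χ < 1 ∧ O = Summit.FinalStateConjecture.exteriorOf 𝒟.toCauchyDevelopment d.charted ∧ Summit.FinalStateConjecture.RaysStayInClosure 𝒟.toCauchyDevelopment O ∧ (∀ i : Fin d.N, Filter.Tendsto (R i) Filter.atTop Filter.atTop ∧ ∀ τ : ℝ, max (Kerr.rPlus (d.mass i) (d.spin i)) 0 + 1 ≤ R i τ) ∧ (∀ τ₁ : ℝ, d.τ₀ < τ₁ → O \ d.certifiedLate R τ₁ ⊆ 𝒟.metric.causalPast 𝒟.timeOrientation (d.certifiedSlab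 R τ₁)) ∧ (∀ i : Fin d.N, Summit.FinalStateConjecture.IsOrthochronous (d.motion i).1) ∧ (∀ (i : Fin d.N) (ρ : ℝ), ∀ᶠ τ in Filter.atTop, ∀ x ∈ (d.background i).truncTimeSlab ρ τ, ∀ w : E4, 𝒟.timeOrientation.IsFutureDirected (mfderiv 𝓘(ℝ, E4) (𝓡 4) (d.chart i) x w) → 0 < ((d.motion i).1 : E4 ≃L[ℝ] E4).symm w 0) ∧ (∀ᶠ τ in Filter.atTop, ∀ x ∈ (Minkowski.backgroundOn d.flatDomain).timeSlab τ, 𝒟.timeOrientation.IsFutureDirected (mfderiv 𝓘(ℝ, E4) (𝓡 4) d.flatChart x (E4.basisVector 0))) ∧ (∀ k : ℕ, Filter.Tendsto (fun τ => 𝒟.toSpacetime.deviationCk (Minkowski.backgroundOn d.flatDomain) d.flatChart k τ) Filter.atTop (nhds 0)) ∧ (∀ (i : Fin d.N) (k : ℕ) (ρ : ℝ) (ε : ENNReal), 0 < ε → ∀ᶠ τ in Filter.atTop, ∃ M a : ℝ, m₀ ≤ M ∧ M ≤ m₀⁻¹ ∧ |a| ≤ χ * M ∧ 𝒟.toSpacetime.truncDeviationCk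 {d.background i with bilin := boostedKerrBilin (d.motion i).1 (d.motion i).2 M a} (d.chart i) k ρ τ ≤ ε ∧ 𝒟.toSpacetime.truncDeviationCk {d.background i with bilin := boostedKerrBilin (d.motion i).1 (d.motion i).2 M a} (d.chart i) k (R i τ) τ ≤ ε)) → ∃ (O : Set 𝒟.carrier) (d : QuasiFinalStateDecomposition 𝒟.toSpacetime O 2 ⊤) (R : Fin d.N → ℝ → ℝ), Summit.FinalStateConjecture.FinalStateConjecture.Theorems.IsHonestEraSystem 𝒟 O d R ∧ (∀ i : Fin d.N, |d.spin i| < d.mass i) ∧ Summit.FinalStateConjecture.FinalStateConjecture.Theorems.HasFrozenConvergence 𝒟.toSpacetime O d R d.mass d.spin := by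
  intro X _ _ _ _ _ _ D hD 𝒟 hmax hI hera
  obtain ⟨m₀, χ, O, d, R, hm₀, hχ, hO, hrays, hR, hexh, horth, hcov, hflat0, hflat, hW, hN⟩ :=
    h₁ X D hD 𝒟 hmax hI hera
  obtain ⟨M, a, hwin, hfix, hgrow⟩ := dyadicCaptureReduction_windowFreezing 𝒟.toSpacetime O d R m₀ χ hm₀ hχ hW
  have hsub : ∀ i : Fin d.N, 0 < M i ∧ |a i| < M i := fun i =>
    dyadicCaptureReduction_subextremal_of_window hm₀ hχ (hwin i).1 (hwin i).2.2
  have hlab : ∀ i : Fin d.N, M i = d.mass i ∧ a i = d.spin i := fun i =>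
    stub_frozenMemberUnique 𝒟.toSpacetime O d i (M i) (a i) (d.mass i) (d.spin i) (hsub i).1 (d.mass_pos i)
      (fun ρ => hfix i 0 ρ) (hN i)
  have hM : M = d.mass := funext fun i => (hlab i).1
  have ha : a = d.spin := funext fun i => (hlab i).2
  subst hM ha
  exact ⟨O, d, R, ⟨hO, hrays, hR, hexh, horth, hcov, hflat0, hflat⟩, fun i => (hsub i).2, ⟨hfix, hgrow⟩⟩

/-- **A frozen, horizon-normalised honest era system settles as the re-typed Statement demands**
(`stub_relabelRechart` with labels matching, then `stub_settledRechart`; the conclusion is the written-out crux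
`ERA → CONCL`, whose ERA antecedent is not used). Sorry-free. [cite: DafermosLuk2017, Conjecture 1 (b)–(c)] -/
theorem dyadicCapture_of_frozenNormalised
    (hF : ∀ (X : Type) [TopologicalSpace X] [ChartedSpace E3 X] [IsManifold (𝓡 3) ((⊤ : ℕ∞) : WithTop ℕ∞) X] [T2Space X] [SecondCountableTopology X] [ConnectedSpace X], ∀ D ∈ admissibleVacuumData X, ∀ 𝒟 : VacuumCauchyDevelopment D, 𝒟.IsMaximal → Summit.FinalStateConjecture.HasCompleteNullInfinity 𝒟.toCauchyDevelopment → (∃ (m₀ χ : ℝ) (O : Set 𝒟.carrier) (d : QuasiFinalStateDecomposition 𝒟.toSpacetime O 2 ⊤) (R : Fin d.N → ℝ → ℝ), 0 < m₀ ∧ χ < 1 ∧ O = Summit.FinalStateConjecture.exteriorOf 𝒟.toCauchyDevelopment d.charted ∧ Summit.FinalStateConjecture.RaysStayInClosure 𝒟.toCauchyDevelopment O ∧ (∀ i : Fin d.N, Filter.Tendsto (R i) Filter.atTop Filter.atTop ∧ ∀ τ : ℝ, max (Kerr.rPlus (d.mass i) (d.spin i)) 0 + 1 ≤ R i τ) ∧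 (∀ τ₁ : ℝ, d.τ₀ < τ₁ → O \ d.certifiedLate R τ₁ ⊆ 𝒟.metric.causalPast 𝒟.timeOrientation (d.certifiedSlab R τ₁)) ∧ (∀ i : Fin d.N, Summit.FinalStateConjecture.IsOrthochronous (d.motion i).1) ∧ (∀ (i : Fin d.N) (ρ : ℝ), ∀ᶠ τ in Filter.atTop, ∀ x ∈ (d.background i).truncTimeSlab ρ τ, ∀ w : E4, 𝒟.timeOrientation.IsFutureDirected (mfderiv 𝓘(ℝ, E4) (𝓡 4) (d.chart i) x w) → 0 < ((d.motion i).1 : E4 ≃L[ℝ] E4).symm w 0) ∧ (∀ᶠ τ in Filter.atTop, ∀ x ∈ (Minkowski.backgroundOn d.flatDomain).timeSlab τ, 𝒟.timeOrientation.IsFutureDirected (mfderiv 𝓘(ℝ, E4) (𝓡 4) d.flatChart x (E4.basisVector 0))) ∧ (∀ k : ℕ, Filter.Tendsto (fun τ => 𝒟.toSpacetime.deviationCk (Minkowski.backgroundOn d.flatDomain) d.flatChart k τ) Filter.atTop (nhds 0)) ∧ (∀ (i : Fin d.N) (k : ℕ) (ρ : ℝ) (ε : ENNReal), 0 < ε →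 ∀ᶠ τ in Filter.atTop, ∃ M a : ℝ, m₀ ≤ M ∧ M ≤ m₀⁻¹ ∧ |a| ≤ χ * M ∧ 𝒟.toSpacetime.truncDeviationCk {d.background i with bilin := boostedKerrBilin (d.motion i).1 (d.motion i).2 M a} (d.chart i) k ρ τ ≤ ε ∧ 𝒟.toSpacetime.truncDeviationCk {d.background i with bilin := boostedKerrBilin (d.motion i).1 (d.motion i).2 M a} (d.chart i) k (R i τ) τ ≤ ε)) → ∃ (O : Set 𝒟.carrier) (d : QuasiFinalStateDecomposition 𝒟.toSpacetime O 2 ⊤) (R : Fin d.N → ℝ → ℝ), Summit.FinalStateConjecture.FinalStateConjecture.Theorems.IsHonestEraSystem 𝒟 O d R ∧ (∀ i : Fin d.N, |d.spin i| < d.mass i) ∧ Summit.FinalStateConjecture.FinalStateConjecture.Theorems.HasFrozenConvergence 𝒟.toSpacetime O d R d.mass d.spin) :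
    ∀ (X : Type) [TopologicalSpace X] [ChartedSpace E3 X] [IsManifold (𝓡 3) ((⊤ : ℕ∞) : WithTop ℕ∞) X] [T2Space X] [SecondCountableTopology X] [ConnectedSpace X], ∀ D ∈ admissibleVacuumData X, ∀ 𝒟 : VacuumCauchyDevelopment D, 𝒟.IsMaximal → Summit.FinalStateConjecture.HasCompleteNullInfinity 𝒟.toCauchyDevelopment → (∃ (m₀ χ : ℝ) (O : Set 𝒟.carrier) (d : QuasiFinalStateDecomposition 𝒟.toSpacetime O 2 ⊤) (R : Fin d.N → ℝ → ℝ), 0 < m₀ ∧ χ < 1 ∧ O = Summit.FinalStateConjecture.exteriorOf 𝒟.toCauchyDevelopment d.charted ∧ Summit.FinalStateConjecture.RaysStayInClosure 𝒟.toCauchyDevelopment O ∧ (∀ i : Fin d.N, Filter.Tendsto (R i) Filter.atTop Filter.atTop ∧ ∀ τ : ℝ, max (Kerr.rPlus (d.mass i) (d.spin i)) 0 + 1 ≤ R i τ) ∧ (∀ τ₁ : ℝ, d.τ₀ < τ₁ → O \ d.certifiedLate R τ₁ ⊆ 𝒟.metric.causalPast 𝒟.timeOrientation (d.certifiedSlab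 R τ₁)) ∧ (∀ i : Fin d.N, Summit.FinalStateConjecture.IsOrthochronous (d.motion i).1) ∧ (∀ (i : Fin d.N) (ρ : ℝ), ∀ᶠ τ in Filter.atTop, ∀ x ∈ (d.background i).truncTimeSlab ρ τ, ∀ w : E4, 𝒟.timeOrientation.IsFutureDirected (mfderiv 𝓘(ℝ, E4) (𝓡 4) (d.chart i) x w) → 0 < ((d.motion i).1 : E4 ≃L[ℝ] E4).symm w 0) ∧ (∀ᶠ τ in Filter.atTop, ∀ x ∈ (Minkowski.backgroundOn d.flatDomain).timeSlab τ, 𝒟.timeOrientation.IsFutureDirected (mfderiv 𝓘(ℝ, E4) (𝓡 4) d.flatChart x (E4.basisVector 0))) ∧ (∀ k : ℕ, Filter.Tendsto (fun τ => 𝒟.toSpacetime.deviationCk (Minkowski.backgroundOn d.flatDomain) d.flatChart k τ) Filter.atTop (nhds 0)) ∧ (∀ (i : Fin d.N) (k : ℕ) (ρ : ℝ) (ε : ENNReal), 0 < ε → ∀ᶠ τ in Filter.atTop, ∃ M a : ℝ, m₀ ≤ M ∧ M ≤ m₀⁻¹ ∧ |a| ≤ χ * M ∧ 𝒟.toSpacetime.truncDeviationCk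 {d.background i with bilin := boostedKerrBilin (d.motion i).1 (d.motion i).2 M a} (d.chart i) k ρ τ ≤ ε ∧ 𝒟.toSpacetime.truncDeviationCk {d.background i with bilin := boostedKerrBilin (d.motion i).1 (d.motion i).2 M a} (d.chart i) k (R i τ) τ ≤ ε)) → (∃ (O' : Set 𝒟.carrier) (d' : FinalStateDecomposition 𝒟.toSpacetime O' 2), (∀ i, Kerr.IsSubextremal (d'.mass i) (d'.spin i)) ∧ O' = Summit.FinalStateConjecture.exteriorOf 𝒟.toCauchyDevelopment d'.charted ∧ Summit.FinalStateConjecture.RaysStayInClosure 𝒟.toCauchyDevelopment O' ∧ Summit.FinalStateConjecture.HasExhaustiveCharts d' ∧ Summit.FinalStateConjecture.IsFutureOriented d') := by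
  intro X _ _ _ _ _ _ D hD 𝒟 hmax hI hera
  obtain ⟨O, d, R, hera', hsub, hfro⟩ := hF X D hD 𝒟 hmax hI hera
  have hsub' : ∀ i : Fin d.N, 0 < d.mass i ∧ |d.spin i| < d.mass i := fun i => ⟨d.mass_pos i, hsub i⟩
  obtain ⟨O', d', h1, h2, h3, h4, h5, h6, h7⟩ :=
    stub_relabelRechart X D hD 𝒟 hmax hI O d R d.mass d.spin hera' hsub' hfro
      fun i => dyadicCaptureReduction_abs_eq (d.mass i) (d.spin i) (d.mass i) (d.spin i) rfl rfl
  exact stub_settledRechart X D hD 𝒟 hmax hI O' d' h1 h2 h3 h4 h5 h6 h7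

/-- **THE REDUCTION.** The written-out crux `DyadicCapture` (`ERA(𝒟) → CONCL(𝒟)`, verbatim the body of
`Summit.FinalStateConjecture.FinalStateConjecture.Theses.LogTimeThreeAnnuli.DyadicCapture`) follows from the single
open stub `stub_normalisedWindowwiseSummability` of line `registered`. A closer proves the hypothesis in a module
that does not import the route file and concludes the crux by `exact dyadicCapture_of_normalisedWindowwiseSummability h`.
Sorry-free, axioms `propext`, `Classical.choice`, `Quot.sound`. [folklore] -/
theorem dyadicCapture_of_normalisedWindowwiseSummability
    (h₁ : ∀ (X : Type) [TopologicalSpace X] [ChartedSpace E3 X] [IsManifold (𝓡 3) ((⊤ : ℕ∞) : WithTop ℕ∞) X] [T2Space X] [SecondCountableTopology X] [ConnectedSpace X], ∀ D ∈ admissibleVacuumData X, ∀ 𝒟 : VacuumCauchyDevelopment D, 𝒟.IsMaximal → Summit.FinalStateConjecture.HasCompleteNullInfinity 𝒟.toCauchyDevelopment → (∃ (m₀ χ : ℝ) (O : Set 𝒟.carrier) (d : QuasiFinalStateDecomposition 𝒟.toSpacetime O 2 ⊤) (R : Fin d.N → ℝ → ℝ), 0 < m₀ ∧ χ < 1 ∧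 O = Summit.FinalStateConjecture.exteriorOf 𝒟.toCauchyDevelopment d.charted ∧ Summit.FinalStateConjecture.RaysStayInClosure 𝒟.toCauchyDevelopment O ∧ (∀ i : Fin d.N, Filter.Tendsto (R i) Filter.atTop Filter.atTop ∧ ∀ τ : ℝ, max (Kerr.rPlus (d.mass i) (d.spin i)) 0 + 1 ≤ R i τ) ∧ (∀ τ₁ : ℝ, d.τ₀ < τ₁ → O \ d.certifiedLate R τ₁ ⊆ 𝒟.metric.causalPast 𝒟.timeOrientation (d.certifiedSlab R τ₁)) ∧ (∀ i : Fin d.N, Summit.FinalStateConjecture.IsOrthochronous (d.motion i).1) ∧ (∀ (i : Fin d.N) (ρ : ℝ), ∀ᶠ τ in Filter.atTop, ∀ x ∈ (d.background i).truncTimeSlab ρ τ, ∀ w : E4, 𝒟.timeOrientation.IsFutureDirected (mfderiv 𝓘(ℝ, E4) (𝓡 4) (d.chart i) x w) → 0 < ((d.motion i).1 : E4 ≃L[ℝ] E4).symm w 0) ∧ (∀ᶠ τ in Filter.atTop, ∀ x ∈ (Minkowski.backgroundOn d.flatDomain).timeSlab τ, 𝒟.timeOrientation.IsFutureDirected (mfderiv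 𝓘(ℝ, E4) (𝓡 4) d.flatChart x (E4.basisVector 0))) ∧ (∀ k : ℕ, Filter.Tendsto (fun τ => 𝒟.toSpacetime.deviationCk (Minkowski.backgroundOn d.flatDomain) d.flatChart k τ) Filter.atTop (nhds 0)) ∧ (∀ (i : Fin d.N) (k : ℕ) (ρ : ℝ) (ε : ENNReal), 0 < ε → ∀ᶠ τ in Filter.atTop, ∃ M a : ℝ, m₀ ≤ M ∧ M ≤ m₀⁻¹ ∧ |a| ≤ χ * M ∧ 𝒟.toSpacetime.truncDeviationCk {d.background i with bilin := boostedKerrBilin (d.motion i).1 (d.motion i).2 M a} (d.chart i) k ρ τ ≤ ε ∧ 𝒟.toSpacetime.truncDeviationCk {d.background i with bilin := boostedKerrBilin (d.motion i).1 (d.motion i).2 M a} (d.chart i) k (R i τ) τ ≤ ε)) → ∃ (m₀ χ : ℝ) (O : Set 𝒟.carrier) (d : QuasiFinalStateDecomposition 𝒟.toSpacetime O 2 ⊤) (R : Fin d.N → ℝ → ℝ), 0 < m₀ ∧ χ < 1 ∧ O = Summit.FinalStateConjecture.exteriorOf 𝒟.toCauchyDevelopment d.charted ∧ Summit.FinalStateConjecture.RaysStayInClosure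 𝒟.toCauchyDevelopment O ∧ (∀ i : Fin d.N, Filter.Tendsto (R i) Filter.atTop Filter.atTop ∧ ∀ τ : ℝ, max (Kerr.rPlus (d.mass i) (d.spin i)) 0 + 1 ≤ R i τ) ∧ (∀ τ₁ : ℝ, d.τ₀ < τ₁ → O \ d.certifiedLate R τ₁ ⊆ 𝒟.metric.causalPast 𝒟.timeOrientation (d.certifiedSlab R τ₁)) ∧ (∀ i : Fin d.N, Summit.FinalStateConjecture.IsOrthochronous (d.motion i).1) ∧ (∀ (i : Fin d.N) (ρ : ℝ), ∀ᶠ τ in Filter.atTop, ∀ x ∈ (d.background i).truncTimeSlab ρ τ, ∀ w : E4, 𝒟.timeOrientation.IsFutureDirected (mfderiv 𝓘(ℝ, E4) (𝓡 4) (d.chart i) x w) → 0 < ((d.motion i).1 : E4 ≃L[ℝ] E4).symm w 0) ∧ (∀ᶠ τ in Filter.atTop, ∀ x ∈ (Minkowski.backgroundOn d.flatDomain).timeSlab τ, 𝒟.timeOrientation.IsFutureDirected (mfderiv 𝓘(ℝ, E4) (𝓡 4) d.flatChart x (E4.basisVector 0))) ∧ (∀ k : ℕ, Filter.Tendsto (fun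 τ => 𝒟.toSpacetime.deviationCk (Minkowski.backgroundOn d.flatDomain) d.flatChart k τ) Filter.atTop (nhds 0)) ∧ (∀ (i : Fin d.N) (k : ℕ) (ρ : ℝ), ∃ n₀ : ℕ, (∑' n : ℕ, ⨅ (M : ℝ) (a : ℝ) (_ : m₀ ≤ M ∧ M ≤ m₀⁻¹ ∧ |a| ≤ χ * M), ⨆ τ ∈ Set.Icc ((2 : ℝ) ^ (n₀ + n)) ((2 : ℝ) ^ (n₀ + n + 1)), (𝒟.toSpacetime.truncDeviationCk {d.background i with bilin := boostedKerrBilin (d.motion i).1 (d.motion i).2 M a} (d.chart i) k ρ τ + 𝒟.toSpacetime.truncDeviationCk {d.background i with bilin := boostedKerrBilin (d.motion i).1 (d.motion i).2 M a} (d.chart i) k (R i τ) τ)) ≠ ⊤) ∧ (∀ (i : Fin d.N) (ρ : ℝ), Filter.Tendsto (fun τ => 𝒟.toSpacetime.truncDeviationCk {d.background i with bilin := boostedKerrBilin (d.motion i).1 (d.motion i).2 (d.mass i) (d.spin i)} (d.chart i) 0 ρ τ) Filter.atTop (nhds 0))) :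
    ∀ (X : Type) [TopologicalSpace X] [ChartedSpace E3 X] [IsManifold (𝓡 3) ((⊤ : ℕ∞) : WithTop ℕ∞) X] [T2Space X] [SecondCountableTopology X] [ConnectedSpace X], ∀ D ∈ admissibleVacuumData X, ∀ 𝒟 : VacuumCauchyDevelopment D, 𝒟.IsMaximal → Summit.FinalStateConjecture.HasCompleteNullInfinity 𝒟.toCauchyDevelopment → (∃ (m₀ χ : ℝ) (O : Set 𝒟.carrier) (d : QuasiFinalStateDecomposition 𝒟.toSpacetime O 2 ⊤) (R : Fin d.N → ℝ → ℝ), 0 < m₀ ∧ χ < 1 ∧ O = Summit.FinalStateConjecture.exteriorOf 𝒟.toCauchyDevelopment d.charted ∧ Summit.FinalStateConjecture.RaysStayInClosure 𝒟.toCauchyDevelopment O ∧ (∀ i : Fin d.N, Filter.Tendsto (R i) Filter.atTop Filter.atTop ∧ ∀ τ : ℝ, max (Kerr.rPlus (d.mass i) (d.spin i)) 0 + 1 ≤ R i τ) ∧ (∀ τ₁ : ℝ, d.τ₀ < τ₁ → O \ d.certifiedLate R τ₁ ⊆ 𝒟.metric.causalPast 𝒟.timeOrientation (d.certifiedSlab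 R τ₁)) ∧ (∀ i : Fin d.N, Summit.FinalStateConjecture.IsOrthochronous (d.motion i).1) ∧ (∀ (i : Fin d.N) (ρ : ℝ), ∀ᶠ τ in Filter.atTop, ∀ x ∈ (d.background i).truncTimeSlab ρ τ, ∀ w : E4, 𝒟.timeOrientation.IsFutureDirected (mfderiv 𝓘(ℝ, E4) (𝓡 4) (d.chart i) x w) → 0 < ((d.motion i).1 : E4 ≃L[ℝ] E4).symm w 0) ∧ (∀ᶠ τ in Filter.atTop, ∀ x ∈ (Minkowski.backgroundOn d.flatDomain).timeSlab τ, 𝒟.timeOrientation.IsFutureDirected (mfderiv 𝓘(ℝ, E4) (𝓡 4) d.flatChart x (E4.basisVector 0))) ∧ (∀ k : ℕ, Filter.Tendsto (fun τ => 𝒟.toSpacetime.deviationCk (Minkowski.backgroundOn d.flatDomain) d.flatChart k τ) Filter.atTop (nhds 0)) ∧ (∀ (i : Fin d.N) (k : ℕ) (ρ : ℝ) (ε : ENNReal), 0 < ε → ∀ᶠ τ in Filter.atTop, ∃ M a : ℝ, m₀ ≤ M ∧ M ≤ m₀⁻¹ ∧ |a| ≤ χ * M ∧ 𝒟.toSpacetime.truncDeviationCk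 {d.background i with bilin := boostedKerrBilin (d.motion i).1 (d.motion i).2 M a} (d.chart i) k ρ τ ≤ ε ∧ 𝒟.toSpacetime.truncDeviationCk {d.background i with bilin := boostedKerrBilin (d.motion i).1 (d.motion i).2 M a} (d.chart i) k (R i τ) τ ≤ ε)) → (∃ (O' : Set 𝒟.carrier) (d' : FinalStateDecomposition 𝒟.toSpacetime O' 2), (∀ i, Kerr.IsSubextremal (d'.mass i) (d'.spin i)) ∧ O' = Summit.FinalStateConjecture.exteriorOf 𝒟.toCauchyDevelopment d'.charted ∧ Summit.FinalStateConjecture.RaysStayInClosure 𝒟.toCauchyDevelopment O' ∧ Summit.FinalStateConjecture.HasExhaustiveCharts d' ∧ Summit.FinalStateConjecture.IsFutureOriented d') :=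
  dyadicCapture_of_frozenNormalised (frozenNormalised_of_normalisedWindowwiseSummability h₁)

end Summit.FinalStateConjecture.FinalStateConjecture.Theorems

end
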